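/-
Copyright (c) 2026 the pub-hodgecm-mathlib formalisation cell (harness21).  Prover seat hodgecm-mathlib-K2-defs1 (g4), Track B ∕ K2-LIT,
h413 = `stmt-HodgeConjecture-24833`, line `K2_E1_TraceFormulaBeta`, page «EIS-RANK-ONE», deal (q3) (D2-e)-B of the dealer K2E1-plan (g4) 2026-09-04T06:53:58Z ∕ 06:58:54Z:
EDITION B of the rank-3 cusp bound over a CM field — the two fibrewise archimedean (iii″) triples of edition A (★ p858097) discharged by ★ PART II from the
archimedean smoothness binders `hφarch` ∕ `hφarchZ` and an envelope `𝓔`.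
-/
import Summits.HodgeConjecture.HodgeConjecture.Theorems.K2E1EisensteinMinusConstantTermBoundedCMThree   -- ★ p858097 edition A (this seat) + everything below it (FILE 1 ★ p858073, ★ PART II, ★ (ν-1)(ν-2), …)
import HarnessLib

/-!
# h413 ∕ Track B «K2-LIT», «EIS-RANK-ONE» (D2-e)-B — `K2E1EisensteinMinusConstantTermBoundedCMThreeArch`:
# `E(f_z) − E(f_z)_B` bounded in the cusp and `Λ^T E(f_z)` bounded on `U(2,1)(𝔸)` over a CM field — EDITION B (archimedean smoothness binders `hφarch`∕`hφarchZ`,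
# envelope masses `h𝓔i`∕`h𝓔N`∕`h𝓔iE`∕`h𝓔NE`, shell sum `hshell`)

Cell `pub/hodgecm-mathlib`, crux H413 = `stmt-HodgeConjecture-24833`, route `HCCMUnconditional`; dealer K2E1-plan (g4), deal (q3) 06:53:58Z ∕ 06:58:54Z (2).  THEOREMS ONLY
(no `def`, no `instance`, no `notation`, no named-fact hypothesis, no `sorry`); lane `--kind proof --supports stmt-HodgeConjecture-24833 --as helper` (count-neutral).
N = 2 twin: ★ p857911 `K2E1EisensteinMinusConstantTermBoundedLevelCMTwo` edition B′ (K2E1-p09 (g5)).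

THE STEP A → B.  Edition A (★ p858097 `exists_bound_sub_borelConstantTerm_level_cm_three`) carries the E-layer triple (`AE`, `N₂E`; `hN₂E hAE hdecArchE`) and the F-layer
triple per centre (`AF`, `N₂F`; `hN₂F0 hAF hdecArchF`).  ★ PART II p857895 (K2E4-p11 (g3)) produces exactly these: `exists_fibre_majorant_centreAverage_of_archSmooth_three`
(E-layer, from `hφarchZ`, `h𝓔iE`, `h𝓔NE`, `h𝓔U`) and `exists_fibre_majorant_centre_of_archSmooth_three` (F-layer, from `hφarch`, `h𝓔i`, `h𝓔N`, `h𝓔U`; `N₂F k X := C'·N X`,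
`k`-free `N`).  So edition B = edition A ∘ PART II, with the binders of PART II carried VERBATIM at the CM pair (`f := flatSectionU φ z`, `K := K_U`), ONE extra sign
binder `hN0 : 0 ≤ N X` (for A's `hN₂F0`; `integral_nonneg` for the payer), and the shell sum `hshell` now `k`-FREE on `N` (edition A's `hshell` at `N₂F k X = C'·N X`,
`BF ↦ C'·BF`).  NAMED binders left and their payers: `hφarch`∕`hφarchZ` ← K2E1-p08 (g5) (a3)₃ (`φ ≡ φ₀`, `𝓔 = C_φ·H^σ`); `h𝓔i`∕`h𝓔N` ← ★ p858088 §3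
`integrable_centreLine_borelHeight_rpow_three` ∕ `exists_forall_integral_centreLine_borelHeight_rpow_le_three` (K2E4-p11 (g4)); `h𝓔iE`∕`h𝓔NE` ← the E-layer integrability
of the centre-line masses; `hshell` ← (D2-f) `exists_forall_tsum_lineMass_dilate_sub_le_three` (`N X = ∫ H^σ`, `θ = 2σ′ − 1`, `2 < σ′ ≤ Re z`; K2E4-p11 (g4)); `h𝓔U` ←
★ PART II ED. 2 `exists_level_binders_borelHeight_rpow_three` for `𝓔 = C·H^σ`; then `hθ` reads `2σ′ ≤ Re z + m∕[L⁺:ℚ]` ✓ (K2E4-p11 (g4) 06:49:46Z consumer check).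

* **`exists_bound_sub_borelConstantTerm_level_cm_three_of_archSmooth`** — `∃ M₁, ∀ g, T < H(g) → ‖E(f_z)(g) − E(f_z)_B(g)‖ ≤ M₁`;
* **`exists_norm_truncation_flatSectionU_le_level_cm_three_of_archSmooth`** — `∃ M, ∀ g, ‖Λ^T E(f_z)(g)‖ ≤ M` (1-call plug ★ p857707).
HONEST LABEL.  Count-neutral helper; proves no printed statement; HC_CM is proved only modulo the 7 printed citations (2 remaining named inputs: hLiu418 =
`stmt-HodgeConjecture-24832`, h413 = `stmt-HodgeConjecture-24833`) until rung 0 closes.  `hφarch`∕`hφarchZ`, the envelope masses and the shell sum are binders here.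

## References
* [MoeglinWaldspurger1995] C. Mœglin, J.-L. Waldspurger, *Spectral decomposition and Eisenstein series* (1995), I.2.10–I.2.13, II.1.7, IV.2.
* [Garrett2018] P. Garrett, *Modern Analysis of Automorphic Forms by Example* 1 (2018), §2.8–§2.11, §12.2.
-/

set_option autoImplicit false
set_option linter.dupNamespace false  -- the mandated namespace repeats the summit's segment (`HodgeConjecture.HodgeConjecture`)

noncomputable section

open MeasureTheory Measure Filter Topology NumberField IsDedekindDomain MulAction Module
open Literature.NumberTheory.Automorphic Literature.NumberTheory.Automorphic.UnitaryGroup Literature.NumberTheory.GaloisRepresentations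
open Summit.HodgeConjecture.HodgeConjecture.Cruxes.H413.K2E1BorelEisensteinU
open Summit.HodgeConjecture.HodgeConjecture.Cruxes.H413.K2E1FlatSectionLineRestrictionArchU3
open Summit.HodgeConjecture.HodgeConjecture.Cruxes.H413.K2E1EisensteinMinusConstantTermBoundedCMThree
open Summit.HodgeConjecture.HodgeConjecture.Cruxes.H413.K2E1TruncatedEisensteinBoundedCMThree
open NumberField.mixedEmbedding
-- `Classical` is needed to see the Mathlib normed-space instances on `mixedSpace` (note H5 of `AdelicGLnGlue`)
open scoped ENNReal NNReal Classical

namespace Summit.HodgeConjecture.HodgeConjecture.Cruxes.H413.K2E1EisensteinMinusConstantTermBoundedCMThreeArch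

variable (L : Type) [Field L] [NumberField L] [IsCMField L]
  [MeasurableSpace (quasiSplit (↥(maximalRealSubfield L)) L (IsCMField.complexConj L) 3).Adelic] [BorelSpace (quasiSplit (↥(maximalRealSubfield L)) L (IsCMField.complexConj L) 3).Adelic]
  [MeasurableSpace (AdeleRing (𝓞 L) L)] [BorelSpace (AdeleRing (𝓞 L) L)]
  [MeasurableSpace (InfiniteAdeleRing L)] [BorelSpace (InfiniteAdeleRing L)]
  [MeasurableSpace (FiniteAdeleRing (𝓞 L) L)] [BorelSpace (FiniteAdeleRing (𝓞 L) L)]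
  [MeasurableSpace (AdeleRing (𝓞 ↥(maximalRealSubfield L)) ↥(maximalRealSubfield L))] [BorelSpace (AdeleRing (𝓞 ↥(maximalRealSubfield L)) ↥(maximalRealSubfield L))]
  [MeasurableSpace (InfiniteAdeleRing ↥(maximalRealSubfield L))] [BorelSpace (InfiniteAdeleRing ↥(maximalRealSubfield L))]
  [MeasurableSpace (FiniteAdeleRing (𝓞 ↥(maximalRealSubfield L)) ↥(maximalRealSubfield L))] [BorelSpace (FiniteAdeleRing (𝓞 ↥(maximalRealSubfield L)) ↥(maximalRealSubfield L))]

/-- **(D2-e)-B, EDITION B — `E(f_z) − E(f_z)_B` IS BOUNDED IN THE CUSP OF `U(2,1)` OVER A CM FIELD** (`2 < Re z`, finite level), from the archimedean smoothness binders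
`hφarch` (centre lines) ∕ `hφarchZ` (centre averages) of ★ PART II with envelope `𝓔`, its masses (`h𝓔i h𝓔N h𝓔iE h𝓔NE`) and the shell sum `hshell`: edition A (★ p858097) ∘ ★ PART II
`exists_fibre_majorant_centre_of_archSmooth_three` ∕ `exists_fibre_majorant_centreAverage_of_archSmooth_three`. [cite: MoeglinWaldspurger1995, I.2.10–I.2.12, II.1.7] [cite: Garrett2018, §2.9, §12.2] -/
theorem exists_bound_sub_borelConstantTerm_level_cm_three_of_archSmooth {δ : L} (hc : IsCMField.complexConj L * IsCMField.complexConj L = 1) (hcδ : IsCMField.complexConj L δ = -δ) (hδ : δ ≠ 0)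
    (ν : Measure ↥(adelicUnipotent ↥(maximalRealSubfield L) L (IsCMField.complexConj L) 3)) [ν.IsHaarMeasure]
    {𝓕 : Set ↥(adelicUnipotent ↥(maximalRealSubfield L) L (IsCMField.complexConj L) 3)} (h𝓕 : IsFundamentalDomain ↥(rationalUnipotent ↥(maximalRealSubfield L) L (IsCMField.complexConj L) 3) 𝓕 ν) (h𝓕c : IsCompact (closure 𝓕))
    (μF : Measure (AdeleRing (𝓞 ↥(maximalRealSubfield L)) ↥(maximalRealSubfield L))) [μF.IsAddHaarMeasure] (μF₁ : Measure (InfiniteAdeleRing ↥(maximalRealSubfield L))) [μF₁.IsAddHaarMeasure]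
    (μF₂ : Measure (FiniteAdeleRing (𝓞 ↥(maximalRealSubfield L)) ↥(maximalRealSubfield L))) [μF₂.IsAddHaarMeasure]
    (μE : Measure (AdeleRing (𝓞 L) L)) [μE.IsAddHaarMeasure] (μE₁ : Measure (InfiniteAdeleRing L)) [μE₁.IsAddHaarMeasure]
    (μE₂ : Measure (FiniteAdeleRing (𝓞 L) L)) [μE₂.IsAddHaarMeasure]
    (χ : HeckeCharacter L) (hχ : χ.IsUnitary) {z : ℂ} (hz : 2 < z.re)
    {φ : (quasiSplit (↥(maximalRealSubfield L)) L (IsCMField.complexConj L) 3).Adelic → ℂ} (hφc : Continuous φ) {Mφ : ℝ} (hφM : ∀ x, ‖φ x‖ ≤ Mφ)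
    (hφB : ∀ b ∈ borelU ((IsCMField.complexConj L : L ≃ₐ[↥(maximalRealSubfield L)] L) : L →+* L) ((StdForm.antidiagonal 3).over L), ∀ x : (quasiSplit (↥(maximalRealSubfield L)) L (IsCMField.complexConj L) 3).Adelic, φ ((quasiSplit (↥(maximalRealSubfield L)) L (IsCMField.complexConj L) 3).toAdelic b * x) = φ x)
    (hf : ∀ (b g : (quasiSplit (↥(maximalRealSubfield L)) L (IsCMField.complexConj L) 3).Adelic) (hb : b ∈ borelAdelic ↥(maximalRealSubfield L) L (IsCMField.complexConj L) 3),
      flatSectionU φ z (b * g) = ((χ (diagUnit hb 0) : ℂˣ) : ℂ) * ((ideleNorm (diagUnit hb 0) : ℝ) : ℂ) ^ z * flatSectionU φ z g)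
    {U₀ : Subgroup (GL (Fin 3) (FiniteAdeleRing (𝓞 L) L))} (hU₀o : IsOpen (U₀ : Set (GL (Fin 3) (FiniteAdeleRing (𝓞 L) L)))) (hU₀K : U₀ ≤ glFiniteIntegralLevel 3 L)
    (hφU : ∀ u : (quasiSplit (↥(maximalRealSubfield L)) L (IsCMField.complexConj L) 3).Adelic, adelicVal ↥(maximalRealSubfield L) L (IsCMField.complexConj L) 3 ((StdForm.antidiagonal 3).over L) u ∈ U₀.map (GLn.ofFinite 3 L) → ∀ y : (quasiSplit (↥(maximalRealSubfield L)) L (IsCMField.complexConj L) 3).Adelic, φ (y * u) = φ y)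
    {T : ℝ≥0} (hT : 1 ≤ T) {m : ℕ} (hm : (finrank ℚ L : ℝ) < m)
    -- the envelope `𝓔` of the big-cell sections: level invariance, centre-line masses `N X` (F-layer), the double-integral mass `NE` (E-layer)
    {𝓔 : (quasiSplit (↥(maximalRealSubfield L)) L (IsCMField.complexConj L) 3).Adelic → ℝ}
    (h𝓔U : ∀ u : (quasiSplit (↥(maximalRealSubfield L)) L (IsCMField.complexConj L) 3).Adelic, adelicVal ↥(maximalRealSubfield L) L (IsCMField.complexConj L) 3 ((StdForm.antidiagonal 3).over L) u ∈ U₀.map (GLn.ofFinite 3 L) → ∀ y : (quasiSplit (↥(maximalRealSubfield L)) L (IsCMField.complexConj L) 3).Adelic, 𝓔 (y * u) = 𝓔 y)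
    {N : AdeleRing (𝓞 L) L → ℝ} (hN0 : ∀ X : AdeleRing (𝓞 L) L, 0 ≤ N X)
    (h𝓔i : ∀ k ∈ ((standardMaximalCompactGL 3 L).comap (adelicVal ↥(maximalRealSubfield L) L (IsCMField.complexConj L) 3 ((StdForm.antidiagonal 3).over L)) : Subgroup (quasiSplit (↥(maximalRealSubfield L)) L (IsCMField.complexConj L) 3).Adelic), ∀ X : AdeleRing (𝓞 L) L, Integrable (fun t : AdeleRing (𝓞 ↥(maximalRealSubfield L)) ↥(maximalRealSubfield L) =>
      𝓔 (((quasiSplit (↥(maximalRealSubfield L)) L (IsCMField.complexConj L) 3).toAdelic (weylLongU ((IsCMField.complexConj L : L ≃ₐ[↥(maximalRealSubfield L)] L) : L →+* L) (rfl : ((StdForm.antidiagonal 3).over L) = ((StdForm.antidiagonal 3).over L)))) *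
        ((heisChart hc (X, traceZeroLine ↥(maximalRealSubfield L) L (IsCMField.complexConj L) hcδ hδ t) : ↥(adelicUnipotent ↥(maximalRealSubfield L) L (IsCMField.complexConj L) 3)) : (quasiSplit (↥(maximalRealSubfield L)) L (IsCMField.complexConj L) 3).Adelic) * k)) μF)
    (h𝓔N : ∀ k ∈ ((standardMaximalCompactGL 3 L).comap (adelicVal ↥(maximalRealSubfield L) L (IsCMField.complexConj L) 3 ((StdForm.antidiagonal 3).over L)) : Subgroup (quasiSplit (↥(maximalRealSubfield L)) L (IsCMField.complexConj L) 3).Adelic), ∀ X : AdeleRing (𝓞 L) L, ∫ t, 𝓔 (((quasiSplit (↥(maximalRealSubfield L)) L (IsCMField.complexConj L) 3).toAdelic (weylLongU ((IsCMField.complexConj L : L ≃ₐ[↥(maximalRealSubfield L)] L) : L →+* L) (rfl : ((StdForm.antidiagonal 3).over L) = ((StdForm.antidiagonal 3).over L)))) *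
        ((heisChart hc (X, traceZeroLine ↥(maximalRealSubfield L) L (IsCMField.complexConj L) hcδ hδ t) : ↥(adelicUnipotent ↥(maximalRealSubfield L) L (IsCMField.complexConj L) 3)) : (quasiSplit (↥(maximalRealSubfield L)) L (IsCMField.complexConj L) 3).Adelic) * k) ∂μF ≤ N X)
    {NE : ℝ}
    (h𝓔iE : ∀ k ∈ ((standardMaximalCompactGL 3 L).comap (adelicVal ↥(maximalRealSubfield L) L (IsCMField.complexConj L) 3 ((StdForm.antidiagonal 3).over L)) : Subgroup (quasiSplit (↥(maximalRealSubfield L)) L (IsCMField.complexConj L) 3).Adelic), Integrable (fun X : AdeleRing (𝓞 L) L => ∫ t, 𝓔 (((quasiSplit (↥(maximalRealSubfield L)) L (IsCMField.complexConj L) 3).toAdelic (weylLongU ((IsCMField.complexConj L : L ≃ₐ[↥(maximalRealSubfield L)] L) : L →+* L) (rfl : ((StdForm.antidiagonal 3).over L) = ((StdForm.antidiagonal 3).over L)))) *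
        ((heisChart hc (X, traceZeroLine ↥(maximalRealSubfield L) L (IsCMField.complexConj L) hcδ hδ t) : ↥(adelicUnipotent ↥(maximalRealSubfield L) L (IsCMField.complexConj L) 3)) : (quasiSplit (↥(maximalRealSubfield L)) L (IsCMField.complexConj L) 3).Adelic) * k) ∂μF) μE)
    (h𝓔NE : ∀ k ∈ ((standardMaximalCompactGL 3 L).comap (adelicVal ↥(maximalRealSubfield L) L (IsCMField.complexConj L) 3 ((StdForm.antidiagonal 3).over L)) : Subgroup (quasiSplit (↥(maximalRealSubfield L)) L (IsCMField.complexConj L) 3).Adelic), ∫ X, ∫ t, 𝓔 (((quasiSplit (↥(maximalRealSubfield L)) L (IsCMField.complexConj L) 3).toAdelic (weylLongU ((IsCMField.complexConj L : L ≃ₐ[↥(maximalRealSubfield L)] L) : L →+* L) (rfl : ((StdForm.antidiagonal 3).over L) = ((StdForm.antidiagonal 3).over L)))) *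
        ((heisChart hc (X, traceZeroLine ↥(maximalRealSubfield L) L (IsCMField.complexConj L) hcδ hδ t) : ↥(adelicUnipotent ↥(maximalRealSubfield L) L (IsCMField.complexConj L) 3)) : (quasiSplit (↥(maximalRealSubfield L)) L (IsCMField.complexConj L) 3).Adelic) * k) ∂μF ∂μE ≤ NE)
    -- the archimedean smoothness binders of ★ PART II, VERBATIM at the CM pair (payer: K2E1-p08 (g5) (a3)₃ at `φ ≡ φ₀`)
    (hφarch : ∀ k ∈ ((standardMaximalCompactGL 3 L).comap (adelicVal ↥(maximalRealSubfield L) L (IsCMField.complexConj L) 3 ((StdForm.antidiagonal 3).over L)) : Subgroup (quasiSplit (↥(maximalRealSubfield L)) L (IsCMField.complexConj L) 3).Adelic), ∀ (X : AdeleRing (𝓞 L) L) (b : FiniteAdeleRing (𝓞 ↥(maximalRealSubfield L)) ↥(maximalRealSubfield L)),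
      ContDiff ℝ m ((fun a : InfiniteAdeleRing ↥(maximalRealSubfield L) => flatSectionU φ z (((quasiSplit (↥(maximalRealSubfield L)) L (IsCMField.complexConj L) 3).toAdelic (weylLongU ((IsCMField.complexConj L : L ≃ₐ[↥(maximalRealSubfield L)] L) : L →+* L) (rfl : ((StdForm.antidiagonal 3).over L) = ((StdForm.antidiagonal 3).over L)))) *
          ((heisChart hc (X, traceZeroLine ↥(maximalRealSubfield L) L (IsCMField.complexConj L) hcδ hδ ((a, b) : AdeleRing (𝓞 ↥(maximalRealSubfield L)) ↥(maximalRealSubfield L))) : ↥(adelicUnipotent ↥(maximalRealSubfield L) L (IsCMField.complexConj L) 3)) : (quasiSplit (↥(maximalRealSubfield L)) L (IsCMField.complexConj L) 3).Adelic) * k)) ∘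
        (InfiniteAdeleRing.ringEquiv_mixedSpace ↥(maximalRealSubfield L)).symm) ∧
      ∀ j : ℕ, j ≤ m → ∀ s : mixedSpace ↥(maximalRealSubfield L),
        ‖iteratedFDeriv ℝ j ((fun a : InfiniteAdeleRing ↥(maximalRealSubfield L) => flatSectionU φ z (((quasiSplit (↥(maximalRealSubfield L)) L (IsCMField.complexConj L) 3).toAdelic (weylLongU ((IsCMField.complexConj L : L ≃ₐ[↥(maximalRealSubfield L)] L) : L →+* L) (rfl : ((StdForm.antidiagonal 3).over L) = ((StdForm.antidiagonal 3).over L)))) *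
          ((heisChart hc (X, traceZeroLine ↥(maximalRealSubfield L) L (IsCMField.complexConj L) hcδ hδ ((a, b) : AdeleRing (𝓞 ↥(maximalRealSubfield L)) ↥(maximalRealSubfield L))) : ↥(adelicUnipotent ↥(maximalRealSubfield L) L (IsCMField.complexConj L) 3)) : (quasiSplit (↥(maximalRealSubfield L)) L (IsCMField.complexConj L) 3).Adelic) * k)) ∘
          (InfiniteAdeleRing.ringEquiv_mixedSpace ↥(maximalRealSubfield L)).symm) s‖ ≤
          𝓔 (((quasiSplit (↥(maximalRealSubfield L)) L (IsCMField.complexConj L) 3).toAdelic (weylLongU ((IsCMField.complexConj L : L ≃ₐ[↥(maximalRealSubfield L)] L) : L →+* L) (rfl : ((StdForm.antidiagonal 3).over L) = ((StdForm.antidiagonal 3).over L)))) *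
          ((heisChart hc (X, traceZeroLine ↥(maximalRealSubfield L) L (IsCMField.complexConj L) hcδ hδ ((((InfiniteAdeleRing.ringEquiv_mixedSpace ↥(maximalRealSubfield L)).symm s), b) : AdeleRing (𝓞 ↥(maximalRealSubfield L)) ↥(maximalRealSubfield L))) : ↥(adelicUnipotent ↥(maximalRealSubfield L) L (IsCMField.complexConj L) 3)) :
            (quasiSplit (↥(maximalRealSubfield L)) L (IsCMField.complexConj L) 3).Adelic) * k))
    (hφarchZ : ∀ k ∈ ((standardMaximalCompactGL 3 L).comap (adelicVal ↥(maximalRealSubfield L) L (IsCMField.complexConj L) 3 ((StdForm.antidiagonal 3).over L)) : Subgroup (quasiSplit (↥(maximalRealSubfield L)) L (IsCMField.complexConj L) 3).Adelic), ∀ B : FiniteAdeleRing (𝓞 L) L,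
      ContDiff ℝ m ((fun a : InfiniteAdeleRing L => ((μF (adeleFundamentalDomain ↥(maximalRealSubfield L))).toReal⁻¹ : ℂ) *
          ∫ t, flatSectionU φ z (((quasiSplit (↥(maximalRealSubfield L)) L (IsCMField.complexConj L) 3).toAdelic (weylLongU ((IsCMField.complexConj L : L ≃ₐ[↥(maximalRealSubfield L)] L) : L →+* L) (rfl : ((StdForm.antidiagonal 3).over L) = ((StdForm.antidiagonal 3).over L)))) *
            ((heisChart hc (((a, B) : AdeleRing (𝓞 L) L), traceZeroLine ↥(maximalRealSubfield L) L (IsCMField.complexConj L) hcδ hδ t) : ↥(adelicUnipotent ↥(maximalRealSubfield L) L (IsCMField.complexConj L) 3)) : (quasiSplit (↥(maximalRealSubfield L)) L (IsCMField.complexConj L) 3).Adelic) * k) ∂μF) ∘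
        (InfiniteAdeleRing.ringEquiv_mixedSpace L).symm) ∧
      ∀ j : ℕ, j ≤ m → ∀ s : mixedSpace L,
        ‖iteratedFDeriv ℝ j ((fun a : InfiniteAdeleRing L => ((μF (adeleFundamentalDomain ↥(maximalRealSubfield L))).toReal⁻¹ : ℂ) *
          ∫ t, flatSectionU φ z (((quasiSplit (↥(maximalRealSubfield L)) L (IsCMField.complexConj L) 3).toAdelic (weylLongU ((IsCMField.complexConj L : L ≃ₐ[↥(maximalRealSubfield L)] L) : L →+* L) (rfl : ((StdForm.antidiagonal 3).over L) = ((StdForm.antidiagonal 3).over L)))) *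
            ((heisChart hc (((a, B) : AdeleRing (𝓞 L) L), traceZeroLine ↥(maximalRealSubfield L) L (IsCMField.complexConj L) hcδ hδ t) : ↥(adelicUnipotent ↥(maximalRealSubfield L) L (IsCMField.complexConj L) 3)) : (quasiSplit (↥(maximalRealSubfield L)) L (IsCMField.complexConj L) 3).Adelic) * k) ∂μF) ∘
          (InfiniteAdeleRing.ringEquiv_mixedSpace L).symm) s‖ ≤
          ∫ t, 𝓔 (((quasiSplit (↥(maximalRealSubfield L)) L (IsCMField.complexConj L) 3).toAdelic (weylLongU ((IsCMField.complexConj L : L ≃ₐ[↥(maximalRealSubfield L)] L) : L →+* L) (rfl : ((StdForm.antidiagonal 3).over L) = ((StdForm.antidiagonal 3).over L)))) *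
            ((heisChart hc (((((InfiniteAdeleRing.ringEquiv_mixedSpace L).symm s), B) : AdeleRing (𝓞 L) L), traceZeroLine ↥(maximalRealSubfield L) L (IsCMField.complexConj L) hcδ hδ t) : ↥(adelicUnipotent ↥(maximalRealSubfield L) L (IsCMField.complexConj L) 3)) :
              (quasiSplit (↥(maximalRealSubfield L)) L (IsCMField.complexConj L) 3).Adelic) * k) ∂μF)
    -- the `x₀`-SHELL SUM, `k`-free, in the (D2-f) head's bytes (payer K2E4-p11 (g4) `exists_forall_tsum_lineMass_dilate_sub_le_three`, `θ = 2σ′ − 1`)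
    {BF θ : ℝ} (hBF : 0 ≤ BF)
    (hshell : ∀ (l₁ : (AdeleRing (𝓞 L) L)ˣ) (l₂ : (AdeleRing (𝓞 ↥(maximalRealSubfield L)) ↥(maximalRealSubfield L))ˣ) (Y : AdeleRing (𝓞 L) L), ((IdeleClassGroup.ideleNorm ↥(maximalRealSubfield L) l₂ : ℝ≥0) : ℝ) ≤ 1 → ((IdeleClassGroup.ideleNorm L l₁ : ℝ≥0) : ℝ) = ((IdeleClassGroup.ideleNorm ↥(maximalRealSubfield L) l₂ : ℝ≥0) : ℝ) →
      (Summable fun x₀ : L => N ((l₁ : AdeleRing (𝓞 L) L) * (algebraMap L (AdeleRing (𝓞 L) L) x₀ - Y))) ∧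
      ∑' x₀ : L, N ((l₁ : AdeleRing (𝓞 L) L) * (algebraMap L (AdeleRing (𝓞 L) L) x₀ - Y)) ≤ BF * (((IdeleClassGroup.ideleNorm ↥(maximalRealSubfield L) l₂ : ℝ≥0) : ℝ)⁻¹) ^ θ)
    (hθ : θ + 1 ≤ z.re + (m : ℝ) / (finrank ℚ ↥(maximalRealSubfield L) : ℝ)) :
    ∃ M₁ : ℝ, ∀ g : (quasiSplit (↥(maximalRealSubfield L)) L (IsCMField.complexConj L) 3).Adelic, T < borelHeight g →
      ‖eisensteinSeriesU (flatSectionU φ z) g - borelConstantTerm ν 𝓕 (eisensteinSeriesU (flatSectionU φ z)) g‖ ≤ M₁ := by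
  have hKc : IsCompact (((standardMaximalCompactGL 3 L).comap (adelicVal ↥(maximalRealSubfield L) L (IsCMField.complexConj L) 3 ((StdForm.antidiagonal 3).over L)) : Subgroup (quasiSplit (↥(maximalRealSubfield L)) L (IsCMField.complexConj L) 3).Adelic) : Set (quasiSplit (↥(maximalRealSubfield L)) L (IsCMField.complexConj L) 3).Adelic) :=
    isCompact_comap_adelicVal_standardMaximalCompactGL
  -- the two fibrewise archimedean triples (★ PART II)
  obtain ⟨C', hC', AF, hAF, hdecArchF⟩ :=
    exists_fibre_majorant_centre_of_archSmooth_three hc hcδ hδ μF μF₁ μF₂ hKc hU₀o h𝓔U h𝓔i h𝓔N hφarch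
  obtain ⟨AE, N₂E, hN₂E, hAE, hdecArchE⟩ :=
    exists_fibre_majorant_centreAverage_of_archSmooth_three hc hcδ hδ μF μE μE₁ μE₂ hKc hU₀o h𝓔U h𝓔iE h𝓔NE hφarchZ
  -- the shell sum at `N₂F k X := C' · N X`
  have hshell' : ∀ k ∈ ((standardMaximalCompactGL 3 L).comap (adelicVal ↥(maximalRealSubfield L) L (IsCMField.complexConj L) 3 ((StdForm.antidiagonal 3).over L)) : Subgroup (quasiSplit (↥(maximalRealSubfield L)) L (IsCMField.complexConj L) 3).Adelic), ∀ (l₁ : (AdeleRing (𝓞 L) L)ˣ) (l₂ : (AdeleRing (𝓞 ↥(maximalRealSubfield L)) ↥(maximalRealSubfield L))ˣ) (Y : AdeleRing (𝓞 L) L), ((IdeleClassGroup.ideleNorm ↥(maximalRealSubfield L) l₂ : ℝ≥0) : ℝ) ≤ 1 → ((IdeleClassGroup.ideleNorm L l₁ : ℝ≥0) : ℝ) = ((IdeleClassGroup.ideleNorm ↥(maximalRealSubfield L) l₂ : ℝ≥0) : ℝ) →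
      (Summable fun x₀ : L => C' * N ((l₁ : AdeleRing (𝓞 L) L) * (algebraMap L (AdeleRing (𝓞 L) L) x₀ - Y))) ∧
      ∑' x₀ : L, C' * N ((l₁ : AdeleRing (𝓞 L) L) * (algebraMap L (AdeleRing (𝓞 L) L) x₀ - Y)) ≤ C' * BF * (((IdeleClassGroup.ideleNorm ↥(maximalRealSubfield L) l₂ : ℝ≥0) : ℝ)⁻¹) ^ θ := by
    intro k _ l₁ l₂ Y hl₂ hl
    obtain ⟨hs, hle⟩ := hshell l₁ l₂ Y hl₂ hl
    refine ⟨hs.mul_left C', ?_⟩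
    rw [tsum_mul_left, mul_assoc]
    exact mul_le_mul_of_nonneg_left hle hC'
  exact exists_bound_sub_borelConstantTerm_level_cm_three L hc hcδ hδ ν h𝓕 h𝓕c μF μF₁ μF₂ μE μE₁ μE₂ χ hχ hz hφc hφM hφB hf hU₀o hU₀K hφU hT hm
    hN₂E hAE hdecArchE (N₂F := fun _ X => C' * N X) (fun _ _ X => mul_nonneg hC' (hN0 X)) hAF hdecArchF (mul_nonneg hC' hBF) hshell' hθ

/-- **`Λ^T E(f_z)` IS BOUNDED ON `U(2,1)(𝔸)` OVER A CM FIELD, EDITION B** — the 1-call composition of the head with ★ p857707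
`exists_norm_truncation_eisensteinSeriesU_flatSectionU_le_cm_three`: `∃ M, ∀ g, ‖Λ^T E(f_z)(g)‖ ≤ M` (R6e's `hΛbdd` at `N = 3`, edition B).
[cite: MoeglinWaldspurger1995, I.2.13, IV.2] [cite: Garrett2018, §2.10–§2.11] -/
theorem exists_norm_truncation_flatSectionU_le_level_cm_three_of_archSmooth {δ : L} (hc : IsCMField.complexConj L * IsCMField.complexConj L = 1) (hcδ : IsCMField.complexConj L δ = -δ) (hδ : δ ≠ 0)
    (ν : Measure ↥(adelicUnipotent ↥(maximalRealSubfield L) L (IsCMField.complexConj L) 3)) [ν.IsHaarMeasure]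
    {𝓕 : Set ↥(adelicUnipotent ↥(maximalRealSubfield L) L (IsCMField.complexConj L) 3)} (h𝓕 : IsFundamentalDomain ↥(rationalUnipotent ↥(maximalRealSubfield L) L (IsCMField.complexConj L) 3) 𝓕 ν) (h𝓕c : IsCompact (closure 𝓕))
    (μF : Measure (AdeleRing (𝓞 ↥(maximalRealSubfield L)) ↥(maximalRealSubfield L))) [μF.IsAddHaarMeasure] (μF₁ : Measure (InfiniteAdeleRing ↥(maximalRealSubfield L))) [μF₁.IsAddHaarMeasure]
    (μF₂ : Measure (FiniteAdeleRing (𝓞 ↥(maximalRealSubfield L)) ↥(maximalRealSubfield L))) [μF₂.IsAddHaarMeasure]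
    (μE : Measure (AdeleRing (𝓞 L) L)) [μE.IsAddHaarMeasure] (μE₁ : Measure (InfiniteAdeleRing L)) [μE₁.IsAddHaarMeasure]
    (μE₂ : Measure (FiniteAdeleRing (𝓞 L) L)) [μE₂.IsAddHaarMeasure]
    (χ : HeckeCharacter L) (hχ : χ.IsUnitary) {z : ℂ} (hz : 2 < z.re)
    {φ : (quasiSplit (↥(maximalRealSubfield L)) L (IsCMField.complexConj L) 3).Adelic → ℂ} (hφc : Continuous φ) {Mφ : ℝ} (hφM : ∀ x, ‖φ x‖ ≤ Mφ)
    (hφB : ∀ b ∈ borelU ((IsCMField.complexConj L : L ≃ₐ[↥(maximalRealSubfield L)] L) : L →+* L) ((StdForm.antidiagonal 3).over L), ∀ x : (quasiSplit (↥(maximalRealSubfield L)) L (IsCMField.complexConj L) 3).Adelic, φ ((quasiSplit (↥(maximalRealSubfield L)) L (IsCMField.complexConj L) 3).toAdelic b * x) = φ x)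
    (hf : ∀ (b g : (quasiSplit (↥(maximalRealSubfield L)) L (IsCMField.complexConj L) 3).Adelic) (hb : b ∈ borelAdelic ↥(maximalRealSubfield L) L (IsCMField.complexConj L) 3),
      flatSectionU φ z (b * g) = ((χ (diagUnit hb 0) : ℂˣ) : ℂ) * ((ideleNorm (diagUnit hb 0) : ℝ) : ℂ) ^ z * flatSectionU φ z g)
    {U₀ : Subgroup (GL (Fin 3) (FiniteAdeleRing (𝓞 L) L))} (hU₀o : IsOpen (U₀ : Set (GL (Fin 3) (FiniteAdeleRing (𝓞 L) L)))) (hU₀K : U₀ ≤ glFiniteIntegralLevel 3 L)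
    (hφU : ∀ u : (quasiSplit (↥(maximalRealSubfield L)) L (IsCMField.complexConj L) 3).Adelic, adelicVal ↥(maximalRealSubfield L) L (IsCMField.complexConj L) 3 ((StdForm.antidiagonal 3).over L) u ∈ U₀.map (GLn.ofFinite 3 L) → ∀ y : (quasiSplit (↥(maximalRealSubfield L)) L (IsCMField.complexConj L) 3).Adelic, φ (y * u) = φ y)
    {T : ℝ≥0} (hT : 1 ≤ T) {m : ℕ} (hm : (finrank ℚ L : ℝ) < m)
    -- the envelope `𝓔` of the big-cell sections: level invariance, centre-line masses `N X` (F-layer), the double-integral mass `NE` (E-layer)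
    {𝓔 : (quasiSplit (↥(maximalRealSubfield L)) L (IsCMField.complexConj L) 3).Adelic → ℝ}
    (h𝓔U : ∀ u : (quasiSplit (↥(maximalRealSubfield L)) L (IsCMField.complexConj L) 3).Adelic, adelicVal ↥(maximalRealSubfield L) L (IsCMField.complexConj L) 3 ((StdForm.antidiagonal 3).over L) u ∈ U₀.map (GLn.ofFinite 3 L) → ∀ y : (quasiSplit (↥(maximalRealSubfield L)) L (IsCMField.complexConj L) 3).Adelic, 𝓔 (y * u) = 𝓔 y)
    {N : AdeleRing (𝓞 L) L → ℝ} (hN0 : ∀ X : AdeleRing (𝓞 L) L, 0 ≤ N X)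
    (h𝓔i : ∀ k ∈ ((standardMaximalCompactGL 3 L).comap (adelicVal ↥(maximalRealSubfield L) L (IsCMField.complexConj L) 3 ((StdForm.antidiagonal 3).over L)) : Subgroup (quasiSplit (↥(maximalRealSubfield L)) L (IsCMField.complexConj L) 3).Adelic), ∀ X : AdeleRing (𝓞 L) L, Integrable (fun t : AdeleRing (𝓞 ↥(maximalRealSubfield L)) ↥(maximalRealSubfield L) =>
      𝓔 (((quasiSplit (↥(maximalRealSubfield L)) L (IsCMField.complexConj L) 3).toAdelic (weylLongU ((IsCMField.complexConj L : L ≃ₐ[↥(maximalRealSubfield L)] L) : L →+* L) (rfl : ((StdForm.antidiagonal 3).over L) = ((StdForm.antidiagonal 3).over L)))) *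
        ((heisChart hc (X, traceZeroLine ↥(maximalRealSubfield L) L (IsCMField.complexConj L) hcδ hδ t) : ↥(adelicUnipotent ↥(maximalRealSubfield L) L (IsCMField.complexConj L) 3)) : (quasiSplit (↥(maximalRealSubfield L)) L (IsCMField.complexConj L) 3).Adelic) * k)) μF)
    (h𝓔N : ∀ k ∈ ((standardMaximalCompactGL 3 L).comap (adelicVal ↥(maximalRealSubfield L) L (IsCMField.complexConj L) 3 ((StdForm.antidiagonal 3).over L)) : Subgroup (quasiSplit (↥(maximalRealSubfield L)) L (IsCMField.complexConj L) 3).Adelic), ∀ X : AdeleRing (𝓞 L) L, ∫ t, 𝓔 (((quasiSplit (↥(maximalRealSubfield L)) L (IsCMField.complexConj L) 3).toAdelic (weylLongU ((IsCMField.complexConj L : L ≃ₐ[↥(maximalRealSubfield L)] L) : L →+* L) (rfl : ((StdForm.antidiagonal 3).over L) = ((StdForm.antidiagonal 3).over L)))) *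
        ((heisChart hc (X, traceZeroLine ↥(maximalRealSubfield L) L (IsCMField.complexConj L) hcδ hδ t) : ↥(adelicUnipotent ↥(maximalRealSubfield L) L (IsCMField.complexConj L) 3)) : (quasiSplit (↥(maximalRealSubfield L)) L (IsCMField.complexConj L) 3).Adelic) * k) ∂μF ≤ N X)
    {NE : ℝ}
    (h𝓔iE : ∀ k ∈ ((standardMaximalCompactGL 3 L).comap (adelicVal ↥(maximalRealSubfield L) L (IsCMField.complexConj L) 3 ((StdForm.antidiagonal 3).over L)) : Subgroup (quasiSplit (↥(maximalRealSubfield L)) L (IsCMField.complexConj L) 3).Adelic), Integrable (fun X : AdeleRing (𝓞 L) L => ∫ t, 𝓔 (((quasiSplit (↥(maximalRealSubfield L)) L (IsCMField.complexConj L) 3).toAdelic (weylLongU ((IsCMField.complexConj L : L ≃ₐ[↥(maximalRealSubfield L)] L) : L →+* L) (rfl : ((StdForm.antidiagonal 3).over L) = ((StdForm.antidiagonal 3).over L)))) *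
        ((heisChart hc (X, traceZeroLine ↥(maximalRealSubfield L) L (IsCMField.complexConj L) hcδ hδ t) : ↥(adelicUnipotent ↥(maximalRealSubfield L) L (IsCMField.complexConj L) 3)) : (quasiSplit (↥(maximalRealSubfield L)) L (IsCMField.complexConj L) 3).Adelic) * k) ∂μF) μE)
    (h𝓔NE : ∀ k ∈ ((standardMaximalCompactGL 3 L).comap (adelicVal ↥(maximalRealSubfield L) L (IsCMField.complexConj L) 3 ((StdForm.antidiagonal 3).over L)) : Subgroup (quasiSplit (↥(maximalRealSubfield L)) L (IsCMField.complexConj L) 3).Adelic), ∫ X, ∫ t, 𝓔 (((quasiSplit (↥(maximalRealSubfield L)) L (IsCMField.complexConj L) 3).toAdelic (weylLongU ((IsCMField.complexConj L : L ≃ₐ[↥(maximalRealSubfield L)] L) : L →+* L) (rfl : ((StdForm.antidiagonal 3).over L) = ((StdForm.antidiagonal 3).over L)))) *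
        ((heisChart hc (X, traceZeroLine ↥(maximalRealSubfield L) L (IsCMField.complexConj L) hcδ hδ t) : ↥(adelicUnipotent ↥(maximalRealSubfield L) L (IsCMField.complexConj L) 3)) : (quasiSplit (↥(maximalRealSubfield L)) L (IsCMField.complexConj L) 3).Adelic) * k) ∂μF ∂μE ≤ NE)
    -- the archimedean smoothness binders of ★ PART II, VERBATIM at the CM pair (payer: K2E1-p08 (g5) (a3)₃ at `φ ≡ φ₀`)
    (hφarch : ∀ k ∈ ((standardMaximalCompactGL 3 L).comap (adelicVal ↥(maximalRealSubfield L) L (IsCMField.complexConj L) 3 ((StdForm.antidiagonal 3).over L)) : Subgroup (quasiSplit (↥(maximalRealSubfield L)) L (IsCMField.complexConj L) 3).Adelic), ∀ (X : AdeleRing (𝓞 L) L) (b : FiniteAdeleRing (𝓞 ↥(maximalRealSubfield L)) ↥(maximalRealSubfield L)),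
      ContDiff ℝ m ((fun a : InfiniteAdeleRing ↥(maximalRealSubfield L) => flatSectionU φ z (((quasiSplit (↥(maximalRealSubfield L)) L (IsCMField.complexConj L) 3).toAdelic (weylLongU ((IsCMField.complexConj L : L ≃ₐ[↥(maximalRealSubfield L)] L) : L →+* L) (rfl : ((StdForm.antidiagonal 3).over L) = ((StdForm.antidiagonal 3).over L)))) *
          ((heisChart hc (X, traceZeroLine ↥(maximalRealSubfield L) L (IsCMField.complexConj L) hcδ hδ ((a, b) : AdeleRing (𝓞 ↥(maximalRealSubfield L)) ↥(maximalRealSubfield L))) : ↥(adelicUnipotent ↥(maximalRealSubfield L) L (IsCMField.complexConj L) 3)) : (quasiSplit (↥(maximalRealSubfield L)) L (IsCMField.complexConj L) 3).Adelic) * k)) ∘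
        (InfiniteAdeleRing.ringEquiv_mixedSpace ↥(maximalRealSubfield L)).symm) ∧
      ∀ j : ℕ, j ≤ m → ∀ s : mixedSpace ↥(maximalRealSubfield L),
        ‖iteratedFDeriv ℝ j ((fun a : InfiniteAdeleRing ↥(maximalRealSubfield L) => flatSectionU φ z (((quasiSplit (↥(maximalRealSubfield L)) L (IsCMField.complexConj L) 3).toAdelic (weylLongU ((IsCMField.complexConj L : L ≃ₐ[↥(maximalRealSubfield L)] L) : L →+* L) (rfl : ((StdForm.antidiagonal 3).over L) = ((StdForm.antidiagonal 3).over L)))) *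
          ((heisChart hc (X, traceZeroLine ↥(maximalRealSubfield L) L (IsCMField.complexConj L) hcδ hδ ((a, b) : AdeleRing (𝓞 ↥(maximalRealSubfield L)) ↥(maximalRealSubfield L))) : ↥(adelicUnipotent ↥(maximalRealSubfield L) L (IsCMField.complexConj L) 3)) : (quasiSplit (↥(maximalRealSubfield L)) L (IsCMField.complexConj L) 3).Adelic) * k)) ∘
          (InfiniteAdeleRing.ringEquiv_mixedSpace ↥(maximalRealSubfield L)).symm) s‖ ≤
          𝓔 (((quasiSplit (↥(maximalRealSubfield L)) L (IsCMField.complexConj L) 3).toAdelic (weylLongU ((IsCMField.complexConj L : L ≃ₐ[↥(maximalRealSubfield L)] L) : L →+* L) (rfl : ((StdForm.antidiagonal 3).over L) = ((StdForm.antidiagonal 3).over L)))) *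
          ((heisChart hc (X, traceZeroLine ↥(maximalRealSubfield L) L (IsCMField.complexConj L) hcδ hδ ((((InfiniteAdeleRing.ringEquiv_mixedSpace ↥(maximalRealSubfield L)).symm s), b) : AdeleRing (𝓞 ↥(maximalRealSubfield L)) ↥(maximalRealSubfield L))) : ↥(adelicUnipotent ↥(maximalRealSubfield L) L (IsCMField.complexConj L) 3)) :
            (quasiSplit (↥(maximalRealSubfield L)) L (IsCMField.complexConj L) 3).Adelic) * k))
    (hφarchZ : ∀ k ∈ ((standardMaximalCompactGL 3 L).comap (adelicVal ↥(maximalRealSubfield L) L (IsCMField.complexConj L) 3 ((StdForm.antidiagonal 3).over L)) : Subgroup (quasiSplit (↥(maximalRealSubfield L)) L (IsCMField.complexConj L) 3).Adelic), ∀ B : FiniteAdeleRing (𝓞 L) L,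
      ContDiff ℝ m ((fun a : InfiniteAdeleRing L => ((μF (adeleFundamentalDomain ↥(maximalRealSubfield L))).toReal⁻¹ : ℂ) *
          ∫ t, flatSectionU φ z (((quasiSplit (↥(maximalRealSubfield L)) L (IsCMField.complexConj L) 3).toAdelic (weylLongU ((IsCMField.complexConj L : L ≃ₐ[↥(maximalRealSubfield L)] L) : L →+* L) (rfl : ((StdForm.antidiagonal 3).over L) = ((StdForm.antidiagonal 3).over L)))) *
            ((heisChart hc (((a, B) : AdeleRing (𝓞 L) L), traceZeroLine ↥(maximalRealSubfield L) L (IsCMField.complexConj L) hcδ hδ t) : ↥(adelicUnipotent ↥(maximalRealSubfield L) L (IsCMField.complexConj L) 3)) : (quasiSplit (↥(maximalRealSubfield L)) L (IsCMField.complexConj L) 3).Adelic) * k) ∂μF) ∘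
        (InfiniteAdeleRing.ringEquiv_mixedSpace L).symm) ∧
      ∀ j : ℕ, j ≤ m → ∀ s : mixedSpace L,
        ‖iteratedFDeriv ℝ j ((fun a : InfiniteAdeleRing L => ((μF (adeleFundamentalDomain ↥(maximalRealSubfield L))).toReal⁻¹ : ℂ) *
          ∫ t, flatSectionU φ z (((quasiSplit (↥(maximalRealSubfield L)) L (IsCMField.complexConj L) 3).toAdelic (weylLongU ((IsCMField.complexConj L : L ≃ₐ[↥(maximalRealSubfield L)] L) : L →+* L) (rfl : ((StdForm.antidiagonal 3).over L) = ((StdForm.antidiagonal 3).over L)))) *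
            ((heisChart hc (((a, B) : AdeleRing (𝓞 L) L), traceZeroLine ↥(maximalRealSubfield L) L (IsCMField.complexConj L) hcδ hδ t) : ↥(adelicUnipotent ↥(maximalRealSubfield L) L (IsCMField.complexConj L) 3)) : (quasiSplit (↥(maximalRealSubfield L)) L (IsCMField.complexConj L) 3).Adelic) * k) ∂μF) ∘
          (InfiniteAdeleRing.ringEquiv_mixedSpace L).symm) s‖ ≤
          ∫ t, 𝓔 (((quasiSplit (↥(maximalRealSubfield L)) L (IsCMField.complexConj L) 3).toAdelic (weylLongU ((IsCMField.complexConj L : L ≃ₐ[↥(maximalRealSubfield L)] L) : L →+* L) (rfl : ((StdForm.antidiagonal 3).over L) = ((StdForm.antidiagonal 3).over L)))) *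
            ((heisChart hc (((((InfiniteAdeleRing.ringEquiv_mixedSpace L).symm s), B) : AdeleRing (𝓞 L) L), traceZeroLine ↥(maximalRealSubfield L) L (IsCMField.complexConj L) hcδ hδ t) : ↥(adelicUnipotent ↥(maximalRealSubfield L) L (IsCMField.complexConj L) 3)) :
              (quasiSplit (↥(maximalRealSubfield L)) L (IsCMField.complexConj L) 3).Adelic) * k) ∂μF)
    -- the `x₀`-SHELL SUM, `k`-free, in the (D2-f) head's bytes (payer K2E4-p11 (g4) `exists_forall_tsum_lineMass_dilate_sub_le_three`, `θ = 2σ′ − 1`)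
    {BF θ : ℝ} (hBF : 0 ≤ BF)
    (hshell : ∀ (l₁ : (AdeleRing (𝓞 L) L)ˣ) (l₂ : (AdeleRing (𝓞 ↥(maximalRealSubfield L)) ↥(maximalRealSubfield L))ˣ) (Y : AdeleRing (𝓞 L) L), ((IdeleClassGroup.ideleNorm ↥(maximalRealSubfield L) l₂ : ℝ≥0) : ℝ) ≤ 1 → ((IdeleClassGroup.ideleNorm L l₁ : ℝ≥0) : ℝ) = ((IdeleClassGroup.ideleNorm ↥(maximalRealSubfield L) l₂ : ℝ≥0) : ℝ) →
      (Summable fun x₀ : L => N ((l₁ : AdeleRing (𝓞 L) L) * (algebraMap L (AdeleRing (𝓞 L) L) x₀ - Y))) ∧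
      ∑' x₀ : L, N ((l₁ : AdeleRing (𝓞 L) L) * (algebraMap L (AdeleRing (𝓞 L) L) x₀ - Y)) ≤ BF * (((IdeleClassGroup.ideleNorm ↥(maximalRealSubfield L) l₂ : ℝ≥0) : ℝ)⁻¹) ^ θ)
    (hθ : θ + 1 ≤ z.re + (m : ℝ) / (finrank ℚ ↥(maximalRealSubfield L) : ℝ)) :
    ∃ M : ℝ, ∀ g : (quasiSplit (↥(maximalRealSubfield L)) L (IsCMField.complexConj L) 3).Adelic, ‖truncation ν 𝓕 T (eisensteinSeriesU (flatSectionU φ z)) g‖ ≤ M := by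
  obtain ⟨M₁, hM₁⟩ := exists_bound_sub_borelConstantTerm_level_cm_three_of_archSmooth L hc hcδ hδ ν h𝓕 h𝓕c μF μF₁ μF₂ μE μE₁ μE₂ χ hχ hz hφc hφM hφB hf hU₀o hU₀K hφU hT hm h𝓔U hN0 h𝓔i h𝓔N h𝓔iE h𝓔NE hφarch hφarchZ hBF hshell hθ
  obtain ⟨M₀, h⟩ := exists_norm_truncation_eisensteinSeriesU_flatSectionU_le_cm_three L ν h𝓕 hT hz hφc hφM hφB hM₁
  exact ⟨max M₀ M₁, h⟩

end Summit.HodgeConjecture.HodgeConjecture.Cruxes.H413.K2E1EisensteinMinusConstantTermBoundedCMThreeArch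

end
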